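import Summits.ResolutionOfSingularities.ResolutionOfSingularities.Theorems.PurelyInseparableDim4WildConesBridge
import Summits.ResolutionOfSingularities.ResolutionOfSingularities.Theorems.WildConesIsolatedForcedTermination
import Summits.ResolutionOfSingularities.ResolutionOfSingularities.Theorems.WildConesClassicalRegimesStubMuDropCharTwoOrdPDict
import Literature.Barriers.ResolutionOfSingularities.ResidualOrderUnboundedBlowup
import HarnessLib
import HarnessLib.Audit.Tags

/-!
# Every prime `p`: no infinite point-blow-up chain of MILNOR-FINITE `p`-fold states
# (bridge WildCones ↔ `PIDim4`, part 3: the frame's `Step0` chains ARE runs of the route `WildCones`)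

[OURS · counted 0 · an assembly of theorems of this tree; nothing here is a statement of any
manuscript, and nothing here proves resolution of singularities in dimension ≥ 4 / characteristic `p`.]

Part 2 (`PurelyInseparableDim4WildConesBridge`) closed F4-I at `(2, 2)` through the route's
formal-pair drop.  This part reads the frame's MODE-0 chains as RUNS of the route's coefficient
dynamics (`WildCones.run`, `Theorems/WildConesClassicalRegimesDefs.lean`) and applies the route's
proved TARGET `IsolatedForcedTermination` (stmt-ResolutionOfSingularities-16343, ALL primes `p`,
all `n`, PERFECT ground fields): no run has every state isolated-in-the-route's-sense
(`WildCones.Isol` = finite formal Milnor algebra `K⟦x⟧ ⧸ ⟨∂₁a, …, ∂ₙa⟩`) of multiplicity `p`.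

* §1 `X_pow_mul_coe_pointTransform_eq_subst` — the chart identity of part 2 for every exponent `q`
  (`X_j^q · ↑pointTransform = subst Φ_{j,b} ↑F`).
* §2 `ser_step_eq_coe_step` — THE DICTIONARY WITHOUT COEFFICIENT CALCULUS: if the route's cleaned
  series of a coefficient function `c` is `↑s.F`, then the route's `step p 4 K j b c` has cleaned
  series `↑(CentreBlowup.step p univ j b s).F` (the route's own `X_pow_mul_serT_eq_subst` says
  `X_j^p · T = subst Φ (ser c)` for its pre-cleaning successor `T`; §1 says the same for
  `↑pointTransform`; cancel `X_j^p` in the domain `K⟦x⟧`; both sides then clean exponent-wise).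
* §3 `noMilnorFiniteStep0Chain` — **for every prime `p` and every PERFECT field `K` of characteristic
  `p` there is no infinite `Step0 p` chain all of whose states (from index `1`) have FINITE formal
  Milnor algebra** (`IsolatedForcedTermination_proof` on the run started at the first successor,
  which is clean).  At `p = 2` with part 1 (`milnorFinite_of_isIsolated_two`) this is a second,
  independent route to `NoIsolatedTrap 2 2` over perfect fields; for `p ≥ 3` it is the honest PARTIAL
  F4-I(p,p): the route's Milnor-finiteness (gradient ideal `⟨∂ᵢF⟩` `𝔪₀`-primary) is STRONGER than the
  frame's isolation of `V(J_p⁺(F))` (all Hasse derivatives of order `< p`), so an infinite isolated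
  `Step0 p` chain, if any, must contain states whose gradient ideal is NOT `𝔪₀`-primary.

bears_on: LADDER-RESOLUTION:D157-DOOR2 (res-dim4-pi · F4-I(p,p) partial).
Supports stmt-ResolutionOfSingularities-16155 (helper).
-/

set_option linter.dupNamespace false

noncomputable section

namespace Summit.ResolutionOfSingularities.ResolutionOfSingularities.Theorems.PIDim4

namespace WildConesBridge

open MvPolynomial Finset
open Literature.AlgebraicGeometry.Resolution
open Literature.AlgebraicGeometry.Resolution.Hauser2010

variable {K : Type} [Field K]

/-! ## 1. The chart identity for every exponent `q` -/

/-- Chart identity, polynomial level, exponent `q`: `x_j^q · F'(x + b) = F(x_j, x_j (x_t + b_t))` for a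
`q`-fold origin and `b_j = 0`. [cite: Hauser2010, §F (chart expressions of a point blowup)] -/
theorem X_pow_mul_pointTransform_eq_aeval (q : ℕ) {s : State K} {j : Fin 4} {b : Fin 4 → K}
    (hb : b j = 0) (hq : (q : ℕ∞) ≤ CentreBlowup.ordAlong Finset.univ s.F) :
    X j ^ q * CentreBlowup.pointTransform q Finset.univ j b s =
      MvPolynomial.aeval (fun t : Fin 4 => if t = j then (X j : MvPolynomial (Fin 4) K)
        else X j * (X t + C (b t))) s.F := by
  have h1 := ChartDictionary.coordBlowupSubst_eq_X_pow_mul_chartTransform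
    (K := K) (Finset.mem_univ j) q s.F hq
  have h3 := congrArg (PointBlowup.translate b) h1
  unfold PointBlowup.translate at h3
  rw [map_mul, map_pow, MvPolynomial.aeval_X, hb, map_zero, add_zero] at h3
  rw [show CentreBlowup.pointTransform q Finset.univ j b s =
      PointBlowup.translate b (CentreBlowup.chartTransform q Finset.univ j s.F) from rfl]
  unfold PointBlowup.translate
  rw [← h3]
  unfold coordBlowupSubst
  rw [← AlgHom.comp_apply, MvPolynomial.comp_aeval]
  refine congrArg (fun f : Fin 4 → MvPolynomial (Fin 4) K => MvPolynomial.aeval f s.F) ?_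
  funext t
  by_cases ht : t = j
  · subst ht
    simp [hb]
  · simp [ht, hb]

/-- Chart identity, formal level, exponent `q`: `X_j^q · ↑pointTransform = subst Φ_{j,b} ↑F` with the
route's substitution `Φ_{j,b}`. [cite: Hauser2010, §F (chart expressions of a point blowup)] -/
theorem X_pow_mul_coe_pointTransform_eq_subst (q : ℕ) {s : State K} {j : Fin 4} {b : Fin 4 → K}
    (hb : b j = 0) (hq : (q : ℕ∞) ≤ CentreBlowup.ordAlong Finset.univ s.F) :
    (MvPowerSeries.X j : MvPowerSeries (Fin 4) K) ^ q *
        ((CentreBlowup.pointTransform q Finset.univ j b s : MvPolynomial (Fin 4) K) :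
          MvPowerSeries (Fin 4) K) =
      MvPowerSeries.subst (fun t : Fin 4 => if t = j then (MvPowerSeries.X j : MvPowerSeries (Fin 4) K)
        else MvPowerSeries.X j * (MvPowerSeries.X t + MvPowerSeries.C (b t)))
        (s.F : MvPowerSeries (Fin 4) K) := by
  rw [MvPowerSeries.subst_coe]
  have hcoe := congrArg (fun P : MvPolynomial (Fin 4) K => (P : MvPowerSeries (Fin 4) K))
    (X_pow_mul_pointTransform_eq_aeval q hb hq)
  simp only [MvPolynomial.coe_mul, MvPolynomial.coe_pow, MvPolynomial.coe_X] at hcoe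
  rw [hcoe]
  set φ : Fin 4 → MvPolynomial (Fin 4) K := fun t => if t = j then (X j : MvPolynomial (Fin 4) K)
    else X j * (X t + C (b t)) with hφ
  set Φ : Fin 4 → MvPowerSeries (Fin 4) K := fun t =>
    if t = j then (MvPowerSeries.X j : MvPowerSeries (Fin 4) K)
    else MvPowerSeries.X j * (MvPowerSeries.X t + MvPowerSeries.C (b t)) with hΦ
  have hφΦ : ∀ t, ((φ t : MvPolynomial (Fin 4) K) : MvPowerSeries (Fin 4) K) = Φ t := by
    intro t
    by_cases ht : t = j
    · simp only [hφ, hΦ, ht, if_true, MvPolynomial.coe_X]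
    · simp only [hφ, hΦ, ht, if_false, MvPolynomial.coe_mul, MvPolynomial.coe_add,
        MvPolynomial.coe_X, MvPolynomial.coe_C]
  have key : (MvPolynomial.coeToMvPowerSeries.ringHom : MvPolynomial (Fin 4) K →+* _).comp
      (MvPolynomial.aeval (R := K) φ).toRingHom = (MvPolynomial.aeval (R := K) Φ).toRingHom := by
    refine MvPolynomial.ringHom_ext (fun r => ?_) (fun t => ?_)
    · simp only [RingHom.comp_apply, AlgHom.toRingHom_eq_coe, RingHom.coe_coe, MvPolynomial.algHom_C,
        MvPolynomial.algebraMap_eq, MvPowerSeries.algebraMap_apply, Algebra.algebraMap_self,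
        RingHom.id_apply]
      exact MvPolynomial.coe_C r
    · simp only [RingHom.comp_apply, AlgHom.toRingHom_eq_coe, RingHom.coe_coe, MvPolynomial.aeval_X]
      exact hφΦ t
  exact RingHom.congr_fun key s.F

/-! ## 2. The dictionary: route steps of corresponding states correspond -/

/-- The route's `p`-th-power test on a raw exponent vector is the tree's `IsPthPowerExponent`.
[folklore] -/
theorem forall_dvd_iff_isPthPowerExponent (p : ℕ) (A : Fin 4 →₀ ℕ) :
    (∀ j, p ∣ A j) ↔ IsPthPowerExponent p A := by
  constructor
  · exact fun h j _ => h j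
  · intro h j
    by_cases hj : j ∈ A.support
    · exact h j hj
    · rw [Finsupp.notMem_support_iff.mp hj]
      exact dvd_zero p

/-- **Correspondence gives multiplicity `p`**: if the route's cleaned series of `c` is `↑F` with
`F ≠ 0` of order `≥ p`, then `MultP p 4 K c`. [folklore] -/
theorem multP_of_ser_eq {p : ℕ} {c : (Fin 4 → ℕ) → K} {F : MvPolynomial (Fin 4) K}
    (hc : WildCones.ser p 4 K c = (F : MvPowerSeries (Fin 4) K)) (hF : F ≠ 0)
    (hq : (p : ℕ∞) ≤ CentreBlowup.ordAlong Finset.univ F) : WildCones.MultP p 4 K c := by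
  have hclean : ∀ A : Fin 4 →₀ ℕ, WildCones.clean p 4 K c ⇑A = coeff A F := fun A => by
    rw [← WildCones.MuDropCharTwoOrdP.coeff_ser c A, hc, MvPolynomial.coeff_coe]
  refine ⟨?_, fun A hA => ?_⟩
  · obtain ⟨d, hd⟩ := MvPolynomial.ne_zero_iff.mp hF
    exact ⟨⇑d, by rwa [hclean d]⟩
  · have hA' : WildCones.clean p 4 K c ⇑(Finsupp.equivFunOnFinite.symm A) ≠ 0 := by
      rwa [Finsupp.coe_equivFunOnFinite_symm]
    rw [hclean] at hA'
    have h := (CentreBlowup.le_ordAlong_iff.mp hq) _ (MvPolynomial.mem_support_iff.mpr hA')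
    rw [CentreBlowup.degIn_univ, Finsupp.degree_eq_sum] at h
    simpa only [Finsupp.coe_equivFunOnFinite_symm] using (show p ≤ _ by exact_mod_cast h)

/-- **Correspondence gives the route's isolation from Milnor-finiteness.** [folklore] -/
theorem isol_of_ser_eq {p : ℕ} {c : (Fin 4 → ℕ) → K} {F : MvPolynomial (Fin 4) K}
    (hc : WildCones.ser p 4 K c = (F : MvPowerSeries (Fin 4) K))
    (hfin : Module.Finite K (MvPowerSeries (Fin 4) K ⧸ Ideal.span (Set.range fun t : Fin 4 =>
      MvPowerSeries.pderiv t (F : MvPowerSeries (Fin 4) K)))) : WildCones.Isol p 4 K c := by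
  rw [WildCones.MuDropCharTwoOrdP.isol_iff_finite_pderiv, hc]
  exact hfin

/-- **THE DICTIONARY, one step.** If the route's cleaned series of `c` is `↑s.F` for a frame state `s`
with `s.F ≠ 0` of order `≥ p`, then for every chart `j` and point `b` with `b_j = 0` the cleaned series
of the route's successor `WildCones.step p 4 K j b c` is `↑(CentreBlowup.step p univ j b s).F` — the
frame's successor.  No coefficient calculus: the route's `X_pow_mul_serT_eq_subst` and §1 give
`X_j^p · T = subst Φ ↑F = X_j^p · ↑pointTransform`, cancel `X_j^p`, then clean exponent-wise.
[folklore] -/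
theorem ser_step_eq_coe_step [DecidableEq K] {p : ℕ} {c : (Fin 4 → ℕ) → K} {s : State K}
    (hc : WildCones.ser p 4 K c = (s.F : MvPowerSeries (Fin 4) K)) (hF : s.F ≠ 0)
    (hq : (p : ℕ∞) ≤ CentreBlowup.ordAlong Finset.univ s.F) {j : Fin 4} {b : Fin 4 → K}
    (hb : b j = 0) :
    WildCones.ser p 4 K (WildCones.step p 4 K j b c) =
      (((CentreBlowup.step p Finset.univ j b s).F : MvPolynomial (Fin 4) K) : MvPowerSeries (Fin 4) K) := by
  classical
  have hM : WildCones.MultP p 4 K c := multP_of_ser_eq hc hF hq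
  -- the route's pre-cleaning successor `T` is `↑pointTransform`
  have hT : (show MvPowerSeries (Fin 4) K from fun A : Fin 4 →₀ ℕ =>
      WildCones.tr 4 K j b p (WildCones.dv 4 K j p (WildCones.bl 4 K j (WildCones.clean p 4 K c))) ⇑A) =
      ((CentreBlowup.pointTransform p Finset.univ j b s : MvPolynomial (Fin 4) K) :
        MvPowerSeries (Fin 4) K) := by
    have hX1 : (MvPowerSeries.X j : MvPowerSeries (Fin 4) K) ≠ 0 := by
      intro h
      have h1 := congrArg (MvPowerSeries.coeff (Finsupp.single j 1)) h
      rw [MvPowerSeries.coeff_X, if_pos rfl, map_zero] at h1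
      exact one_ne_zero h1
    apply mul_left_cancel₀ (pow_ne_zero p hX1)
    rw [WildCones.MuDropCharTwoOrdP.X_pow_mul_serT_eq_subst c j b hM, hc,
      X_pow_mul_coe_pointTransform_eq_subst p hb hq]
  ext A
  rw [WildCones.MuDropCharTwoOrdP.coeff_ser_step c j b hM A, MvPolynomial.coeff_coe]
  show @ite K (∀ i : Fin 4, p ∣ (⇑A) i) (Classical.dec _) (0 : K)
      (WildCones.tr 4 K j b p (WildCones.dv 4 K j p (WildCones.bl 4 K j (WildCones.clean p 4 K c))) ⇑A) = _
  have hTA : WildCones.tr 4 K j b p (WildCones.dv 4 K j p (WildCones.bl 4 K j (WildCones.clean p 4 K c))) ⇑A =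
      coeff A (CentreBlowup.pointTransform p Finset.univ j b s) := by
    have := congrArg (MvPowerSeries.coeff A) hT
    rwa [MvPolynomial.coeff_coe] at this
  rw [hTA]
  show _ = coeff A (deletePthPowers p (CentreBlowup.pointTransform p Finset.univ j b s))
  rw [coeff_deletePthPowers]
  by_cases hA : ∀ i, p ∣ (⇑A) i
  · rw [if_pos hA, if_pos ((forall_dvd_iff_isPthPowerExponent p A).mp hA)]
  · rw [if_neg hA, if_neg (fun h => hA ((forall_dvd_iff_isPthPowerExponent p A).mpr h))]

/-- A clean polynomial IS the cleaned series of its own coefficient function. [folklore] -/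
theorem ser_coeffFun_eq_coe_of_isClean {p : ℕ} {F : MvPolynomial (Fin 4) K}
    (hclean : Literature.Barriers.ResolutionOfSingularities.HauserPerlega.IsClean p F) :
    WildCones.ser p 4 K (fun A : Fin 4 → ℕ => coeff (Finsupp.equivFunOnFinite.symm A) F) =
      (F : MvPowerSeries (Fin 4) K) := by
  classical
  ext A
  rw [WildCones.MuDropCharTwoOrdP.coeff_ser, MvPolynomial.coeff_coe]
  show @ite K (∀ i : Fin 4, p ∣ (⇑A) i) (Classical.dec _) (0 : K)
      (coeff (Finsupp.equivFunOnFinite.symm ⇑A) F) = _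
  rw [Finsupp.equivFunOnFinite_symm_coe]
  by_cases hA : ∀ i, p ∣ (⇑A) i
  · rw [if_pos hA]
    by_contra hne
    exact hclean A (MvPolynomial.mem_support_iff.mpr (Ne.symm hne))
      ((forall_dvd_iff_isPthPowerExponent p A).mp hA)
  · rw [if_neg hA]

/-! ## 3. Every prime: no infinite `Step0` chain of Milnor-finite states -/

/-- **For every prime `p` and every PERFECT field of characteristic `p`: there is no infinite `Step0 p`
chain of the frame whose states from index `1` on have FINITE formal Milnor algebra
`K⟦x⟧ ⧸ ⟨∂₁↑F, …, ∂₄↑F⟩`.**  The chain from index `1` (clean states: `HauserPerlega.isClean_deletePthPowers`) is a run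
of the route `WildCones` (§2), every state of which is `Isol ∧ MultP`; the route's proved target
`IsolatedForcedTermination` (stmt-ResolutionOfSingularities-16343) excludes such runs.  For `p ≥ 3` this
is the PARTIAL form of F4-I(p,p) (Milnor-finite ⊊ `IsIsolated p`); at `p = 2` see part 2 for the full
statement over every field. [OURS · counted 0]
[cite: HauserPerlega2019, §1 p. 3 (the forced-cycle question, answered in the tree for Milnor-finite runs)] -/
theorem noMilnorFiniteStep0Chain (p : ℕ) (hp : p.Prime) (K : Type) [Field K] [CharP K p]
    [PerfectField K] [DecidableEq K] :
    ¬ ∃ c : ℕ → State K, ∀ k, Step0 p (c k) (c (k + 1)) ∧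
      Module.Finite K (MvPowerSeries (Fin 4) K ⧸ Ideal.span (Set.range fun t : Fin 4 =>
        MvPowerSeries.pderiv t (((c (k + 1)).F : MvPolynomial (Fin 4) K) : MvPowerSeries (Fin 4) K))) := by
  classical
  rintro ⟨c, hc⟩
  -- chart and point words of the chain, read from the edges `c (k+1) → c (k+2)`
  have hedge : ∀ k, ∃ (j : Fin 4) (b : Fin 4 → K), b j = 0 ∧
      (CentreBlowup.step p Finset.univ j b (c (k + 1))).F ≠ 0 ∧
      c (k + 1 + 1) = CentreBlowup.step p Finset.univ j b (c (k + 1)) := fun k => by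
    obtain ⟨-, j, b, -, hb, -, hne, hck⟩ := (hc (k + 1)).1
    exact ⟨j, b, hb, hne, hck⟩
  choose jw bw hbw hnew hcw using hedge
  -- the run of the route started at the (clean) first successor
  set c₀ : (Fin 4 → ℕ) → K := fun A => coeff (Finsupp.equivFunOnFinite.symm A) (c 1).F with hc₀
  have hser : ∀ m, WildCones.ser p 4 K (WildCones.run p 4 K c₀ jw bw m) =
      (((c (m + 1)).F : MvPolynomial (Fin 4) K) : MvPowerSeries (Fin 4) K) := by
    intro m
    induction m with
    | zero =>
      obtain ⟨-, j, b, -, -, -, -, hc1⟩ := (hc 0).1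
      have hclean : Literature.Barriers.ResolutionOfSingularities.HauserPerlega.IsClean p (c 1).F := by
        rw [hc1]
        exact Literature.Barriers.ResolutionOfSingularities.HauserPerlega.isClean_deletePthPowers p _
      exact ser_coeffFun_eq_coe_of_isClean hclean
    | succ m ih =>
      have hF : (c (m + 1)).F ≠ 0 := by
        cases m with
        | zero =>
          obtain ⟨-, j, b, -, -, -, hne, hc1⟩ := (hc 0).1
          rw [hc1]; exact hne
        | succ m => rw [hcw m]; exact hnew m
      show WildCones.ser p 4 K (WildCones.step p 4 K (jw m) (bw m) (WildCones.run p 4 K c₀ jw bw m)) = _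
      rw [ser_step_eq_coe_step ih hF (hc (m + 1)).1.1 (hbw m), ← hcw m]
  -- every state of the run is `Isol ∧ MultP`
  have hInf : WildCones.InfRun p 4 K c₀ jw bw := fun m => by
    have hF : (c (m + 1)).F ≠ 0 := by
      cases m with
      | zero =>
        obtain ⟨-, j, b, -, -, -, hne, hc1⟩ := (hc 0).1
        rw [hc1]; exact hne
      | succ m => rw [hcw m]; exact hnew m
    exact ⟨isol_of_ser_eq (hser m) (hc m).2, multP_of_ser_eq (hser m) hF (hc (m + 1)).1.1⟩
  exact WildCones.IsolatedForcedTermination_proof p hp 4 (by norm_num) K c₀ jw bw hInf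

/-- **At `p = 2` over a perfect field**, the ISOLATED chains are among the Milnor-finite ones (part 1),
so §3 re-derives F4-I(2,2) there by the route's target rather than by its formal-pair drop — a second,
independent path (K-redundancy; part 2's `noIsolatedTrap_two_two` needs no perfectness). [OURS · counted 0]
[folklore] -/
theorem no_isolated_step0_chain_two_of_perfect (K : Type) [Field K] [CharP K 2] [PerfectField K]
    [DecidableEq K] :
    ¬ ∃ c : ℕ → State K, ∀ k, IsIsolated 2 (c k).F ∧ Step0 2 (c k) (c (k + 1)) := by
  rintro ⟨c, hc⟩
  exact noMilnorFiniteStep0Chain 2 Nat.prime_two K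
    ⟨c, fun k => ⟨(hc k).2, milnorFinite_of_isIsolated_two (hc (k + 1)).1⟩⟩

end WildConesBridge

end Summit.ResolutionOfSingularities.ResolutionOfSingularities.Theorems.PIDim4

end
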